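import Summits.KontsevichZagierPeriods.Zeta5Search.Barrier.ConeGammaCuspSymmetricPatterns

/-!
# ζ(5) search — BARRIER: the EXACT symmetric part at a two-wall junction — `D_b · |φ_{k₁}(δ)/h_{k₁} − φ_{k₂}(δ)/h_{k₂}|`

HONEST FRAMING (cell `pub-zeta5`): systematic search; no irrationality claim unless kernel-certified. MODEL objects
under Brown–Zudilin's (28)+(30) accounting ([BZ22] = arXiv:2210.03391; (28) observed, not proved); nothing here is a
statement about `ζ(5)`, any `γ` of record, the cone's supremum (C2 OPEN) or the value of `D_b` at any named direction
(DATA of the cell); S-E stays CONJECTURED; records in print UNMOVED. Prover P2 g25, last companion of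
`ConeGammaCuspSymmetricWalls` / `…Patterns` (item (c) of P2 g23's list; lead's GO lit g37 INBOX l.9234, (M)).

`germ_symm_sign_of_two_wall` gave the SIGN of the four-germ sum `R_b(δ)` at a two-wall junction. Here is its VALUE:
* **`refl_two_wall_defect`** — at a breakpoint with exactly two member forms `k₁ ≠ k₂`, a small displacement `Δ` with
  `φ_{k₁}(Δ)·φ_{k₂}(Δ) < 0` has reflection defect `D_b` (read at the mixed reference `Δ₁`), and one with
  `φ_{k₁}(Δ)·φ_{k₂}(Δ) > 0` has defect `0`;
* **`germ_symm_eq_two_wall`** — for every displacement `δ` and admissible scale (`0 < η`, `ηK < 1`, `ηK < wallDist`):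
  `R_b(δ) = D_b · |φ_{k₁}(δ)/h_{k₁}(a) − φ_{k₂}(δ)/h_{k₂}(a)|` — the junction's fixed vote `D_b` weighted by how far `δ`
  SPLITS its two walls (the mixed region of `w` is an interval of that length together with its mirror image; the
  desk identity `K_b(δ)+K_b(−δ) = D_b·|r₁ − r₂|` of `HOME/pub-zeta5-p2/g25/alg/twowall.py`, now a theorem).
NOT here (honest): `≥ 3`-wall values; anything about `γ`, C2, S-E, `ζ(5)`.
-/

noncomputable section

open Set MeasureTheory
open scoped Topology

namespace Summit.KontsevichZagierPeriods.Zeta5Search.Barrier.ConeGamma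

/-- `(x − p)(x − q) < 0 ↔ x` lies strictly between `p` and `q`. -/
theorem mul_sub_sub_neg_iff_mem_Ioo (x p q : ℝ) : (x - p) * (x - q) < 0 ↔ x ∈ Ioo (min p q) (max p q) := by
  rw [mul_neg_iff, Set.mem_Ioo, min_lt_iff, lt_max_iff, sub_pos, sub_neg, sub_pos, sub_neg]
  constructor
  · rintro (⟨h1, h2⟩ | ⟨h1, h2⟩)
    · exact ⟨Or.inl h1, Or.inr h2⟩
    · exact ⟨Or.inr h2, Or.inl h1⟩
  · rintro ⟨h1 | h1, h2 | h2⟩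
    · exact absurd (h1.trans h2) (lt_irrefl _)
    · exact Or.inl ⟨h1, h2⟩
    · exact Or.inr ⟨h2, h1⟩
    · exact absurd (h1.trans h2) (lt_irrefl _)

/-- **The reflection defect at a two-wall junction, decided by the sign of `φ_{k₁}(Δ)·φ_{k₂}(Δ)`**: mixed signs give
`D_b` (the value at the mixed reference `Δ₁`), equal signs give `0`. -/
theorem refl_two_wall_defect {a : Dir} (hpos : ∀ k, 0 < h28 a k) {T b : ℝ} (hb : b ∈ bkpts a T)
    {k₁ k₂ : Fin 28} (hother : ∀ k, k ≠ k₁ → k ≠ k₂ → ∀ z : ℤ, b * h28 a k ≠ z) {Δ Δ₁ : Fin 8 → ℝ}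
    (hΔ1 : ∀ k, |phiForm Δ k| < 1) (hΔ2 : ∀ k, |phiForm Δ k| < wallDist a T)
    (hΔ₁1 : ∀ k, |phiForm Δ₁ k| < 1) (hΔ₁2 : ∀ k, |phiForm Δ₁ k| < wallDist a T)
    (hm1 : 0 < phiForm Δ₁ k₁) (hm2 : phiForm Δ₁ k₂ < 0)
    {t : ℝ} (ht : 0 < t) (ht1 : t * xMax a < 1) (ht2 : t * xMax a < wallDist a T) :
    (phiForm Δ k₁ * phiForm Δ k₂ < 0 →
      (torusN (b • sParam a + Δ) : ℝ) + torusN (b • sParam a - Δ) -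
          (torusN (b • sParam a + t • sParam a) + torusN (b • sParam a - t • sParam a)) =
        (torusN (b • sParam a + Δ₁) : ℝ) + torusN (b • sParam a - Δ₁) -
          (torusN (b • sParam a + t • sParam a) + torusN (b • sParam a - t • sParam a))) ∧
    (0 < phiForm Δ k₁ * phiForm Δ k₂ →
      (torusN (b • sParam a + Δ) : ℝ) + torusN (b • sParam a - Δ) -
          (torusN (b • sParam a + t • sParam a) + torusN (b • sParam a - t • sParam a)) = 0) := by
  have hT1 : ∀ k, |phiForm (t • sParam a) k| < 1 := fun k => by
    obtain ⟨e, le⟩ := abs_phiForm_line_step hpos ht k; rw [e]; exact le.trans_lt ht1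
  have hT2 : ∀ k, |phiForm (t • sParam a) k| < wallDist a T := fun k => by
    obtain ⟨e, le⟩ := abs_phiForm_line_step hpos ht k; rw [e]; exact le.trans_lt ht2
  have hpt : ∀ k, 0 < phiForm (t • sParam a) k := fun k => by rw [phiForm_smul_sParam]; exact mul_pos ht (hpos k)
  have hmem : ∀ k, (∃ z : ℤ, b * h28 a k = z) → k = k₁ ∨ k = k₂ := by
    intro k ⟨z, hz⟩
    by_contra h
    push Not at h
    exact hother k h.1 h.2 z hz
  constructor
  · intro hneg
    have e : torusN (b • sParam a + Δ) + torusN (b • sParam a - Δ) =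
        torusN (b • sParam a + Δ₁) + torusN (b • sParam a - Δ₁) := by
      rcases mul_neg_iff.mp hneg with ⟨h1, h2⟩ | ⟨h1, h2⟩
      · exact torusN_pair_eq_of_member_signs hb hΔ1 hΔ2 hΔ₁1 hΔ₁2 fun k hk => by
          rcases hmem k hk with rfl | rfl
          · exact Or.inl ⟨h1, hm1⟩
          · exact Or.inr ⟨h2, hm2⟩
      · exact torusN_pair_eq_of_member_antisigns hb hΔ1 hΔ2 hΔ₁1 hΔ₁2 fun k hk => by
          rcases hmem k hk with rfl | rfl
          · exact Or.inr ⟨h1, hm1⟩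
          · exact Or.inl ⟨h2, hm2⟩
    have e' : (torusN (b • sParam a + Δ) : ℝ) + torusN (b • sParam a - Δ) =
        torusN (b • sParam a + Δ₁) + torusN (b • sParam a - Δ₁) := by exact_mod_cast e
    rw [e']
  · intro hp
    rw [sub_eq_zero]
    rcases mul_pos_iff.mp hp with ⟨h1, h2⟩ | ⟨h1, h2⟩
    · exact_mod_cast torusN_pair_eq_of_member_signs hb hΔ1 hΔ2 hT1 hT2 fun k hk => by
        rcases hmem k hk with rfl | rfl
        · exact Or.inl ⟨h1, hpt _⟩
        · exact Or.inl ⟨h2, hpt _⟩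
    · exact_mod_cast torusN_pair_eq_of_member_antisigns hb hΔ1 hΔ2 hT1 hT2 fun k hk => by
        rcases hmem k hk with rfl | rfl
        · exact Or.inr ⟨h1, hpt _⟩
        · exact Or.inr ⟨h2, hpt _⟩

/-- The integral of the indicator of an open interval inside `[−W, W]` is its length. -/
theorem intervalIntegral_indicator_Ioo {W m M : ℝ} (hWm : -W ≤ m) (hmM : m ≤ M) (hMW : M ≤ W) :
    ∫ x in (-W)..W, (Ioo m M).indicator (fun _ => (1 : ℝ)) x = M - m := by
  rw [intervalIntegral.integral_of_le (by linarith), integral_indicator measurableSet_Ioo,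
    Measure.restrict_restrict measurableSet_Ioo, setIntegral_const, smul_eq_mul, mul_one,
    show Ioo m M ∩ Ioc (-W) W = Ioo m M from
      inter_eq_left.mpr fun x hx => ⟨lt_of_le_of_lt hWm hx.1, hx.2.le.trans hMW⟩,
    measureReal_def, Real.volume_Ioo, ENNReal.toReal_ofReal (by linarith)]

/-- **THE EXACT SYMMETRIC PART AT A TWO-WALL JUNCTION.** Let `b ∈ bkpts a T` have all its member forms among
`k₁, k₂` (`hother`; with fewer members both sides vanish), let `D_b` be the reflection defect at a small mixed reference displacement `Δ₁`
(`φ_{k₁}(Δ₁) > 0 > φ_{k₂}(Δ₁)`) against a small line step `t > 0`, and let `0 < η` with `ηK < 1`, `ηK < wallDist`.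
Then for EVERY displacement `δ`:
`germR(δ) + germL(δ) + germR(−δ) + germL(−δ) = D_b · |φ_{k₁}(δ)/h_{k₁}(a) − φ_{k₂}(δ)/h_{k₂}(a)|`. -/
theorem germ_symm_eq_two_wall {a : Dir} (hpos : ∀ k, 0 < h28 a k) {T b : ℝ} (hb : b ∈ bkpts a T)
    {k₁ k₂ : Fin 28} (hother : ∀ k, k ≠ k₁ → k ≠ k₂ → ∀ z : ℤ, b * h28 a k ≠ z) (δ : Fin 8 → ℝ)
    {η : ℝ} (hη : 0 < η) (h1 : η * clusterBound a δ < 1) (h2 : η * clusterBound a δ < wallDist a T)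
    {Δ₁ : Fin 8 → ℝ} (hΔ₁1 : ∀ k, |phiForm Δ₁ k| < 1) (hΔ₁2 : ∀ k, |phiForm Δ₁ k| < wallDist a T)
    (hm1 : 0 < phiForm Δ₁ k₁) (hm2 : phiForm Δ₁ k₂ < 0) {t : ℝ} (ht : 0 < t) (ht1 : t * xMax a < 1)
    (ht2 : t * xMax a < wallDist a T) :
    germR a δ η b + germL a δ η b + germR a (-δ) η b + germL a (-δ) η b =
      ((torusN (b • sParam a + Δ₁) : ℝ) + torusN (b • sParam a - Δ₁) -
          (torusN (b • sParam a + t • sParam a) + torusN (b • sParam a - t • sParam a))) *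
        |phiForm δ k₁ / h28 a k₁ - phiForm δ k₂ / h28 a k₂| := by
  rw [germ_symm_eq_integral_refl]
  have hW := clusterWidth_pos hpos δ
  have hh1 := hpos k₁
  have hh2 := hpos k₂
  -- notation: the junction's vote, the two splittings, the mixed interval and its indicator
  set D : ℝ := (torusN (b • sParam a + Δ₁) : ℝ) + torusN (b • sParam a - Δ₁) -
    (torusN (b • sParam a + t • sParam a) + torusN (b • sParam a - t • sParam a)) with hD
  set r₁ : ℝ := phiForm δ k₁ / h28 a k₁ with hr₁
  set r₂ : ℝ := phiForm δ k₂ / h28 a k₂ with hr₂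
  set m : ℝ := min (-r₁) (-r₂) with hm
  set M : ℝ := max (-r₁) (-r₂) with hM
  set g : ℝ → ℝ := (Ioo m M).indicator fun _ => (1 : ℝ) with hg
  -- the splittings are smaller than `W`
  have hrW : ∀ (k : Fin 28), |phiForm δ k / h28 a k| ≤ clusterWidth a δ := by
    intro k
    rw [abs_div, abs_of_pos (hpos k), div_le_iff₀ (hpos k)]
    have h1 := abs_phiForm_le_shiftSize δ k
    have h2 := shiftSize_le_div_mul hpos δ k
    have h3 : shiftSize δ / xMin a * h28 a k ≤ clusterWidth a δ * h28 a k := by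
      unfold clusterWidth; nlinarith [hpos k]
    linarith
  have hmW : -clusterWidth a δ ≤ m := by
    rw [hm, le_min_iff]
    exact ⟨by linarith [(abs_le.mp (hrW k₁)).2], by linarith [(abs_le.mp (hrW k₂)).2]⟩
  have hMW : M ≤ clusterWidth a δ := by
    rw [hM, max_le_iff]
    exact ⟨by linarith [(abs_le.mp (hrW k₁)).1], by linarith [(abs_le.mp (hrW k₂)).1]⟩
  have hmM : m ≤ M := min_le_max
  -- Step A: a.e. on `(0, W]` the integrand is `D·(g(w) + g(−w))`
  set B : Set ℝ := {(-phiForm δ k₁) / h28 a k₁, phiForm δ k₁ / h28 a k₁, (-phiForm δ k₂) / h28 a k₂,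
    phiForm δ k₂ / h28 a k₂} with hBdef
  have hBfin : B.Finite := by
    rw [hBdef]; exact (((Set.finite_singleton _).insert _).insert _).insert _
  have hae : ∀ᵐ w ∂volume, w ∉ B := (measure_eq_zero_iff_ae_notMem).mp (hBfin.measure_zero volume)
  have hA : ∫ w in (0 : ℝ)..clusterWidth a δ,
      ((shiftDiff a δ η (b + η * w) + shiftDiff a (-δ) η (b - η * w)) +
        (shiftDiff a (-δ) η (b + η * w) + shiftDiff a δ η (b - η * w))) =
      ∫ w in (0 : ℝ)..clusterWidth a δ, (D * g w + D * g (-w)) := by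
    refine intervalIntegral.integral_congr_ae ?_
    filter_upwards [hae] with w hwB hwI
    rw [uIoc_of_le hW.le] at hwI
    obtain ⟨hw0, hwW⟩ := hwI
    obtain ⟨⟨hDp1, hDp2, hDm1, hDm2⟩, hform, hF⟩ :=
      refl_integrand_eq_defects hpos hb δ hη h1 h2 ht ht1 ht2 hw0 hwW
    rw [hF]
    have ne : ∀ {c : ℝ} {k : Fin 28}, 0 < h28 a k → w ≠ c / h28 a k → w * h28 a k - c ≠ 0 :=
      fun hk hne h => hne (by field_simp; linarith)
    have n1p : w * h28 a k₁ + phiForm δ k₁ ≠ 0 := by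
      have := ne hh1 (fun h => hwB (by rw [hBdef]; exact Or.inl h)); rwa [sub_neg_eq_add] at this
    have n1m : w * h28 a k₁ - phiForm δ k₁ ≠ 0 := ne hh1 fun h => hwB (by rw [hBdef]; exact Or.inr (Or.inl h))
    have n2p : w * h28 a k₂ + phiForm δ k₂ ≠ 0 := by
      have := ne hh2 (fun h => hwB (by rw [hBdef]; exact Or.inr (Or.inr (Or.inl h))))
      rwa [sub_neg_eq_add] at this
    have n2m : w * h28 a k₂ - phiForm δ k₂ ≠ 0 :=
      ne hh2 fun h => hwB (by rw [hBdef]; exact Or.inr (Or.inr (Or.inr h)))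
    -- the products of the member forms, factored
    have hh1' : h28 a k₁ ≠ 0 := hh1.ne'
    have hh2' : h28 a k₂ ≠ 0 := hh2.ne'
    have e1p : w - -r₁ = (w * h28 a k₁ + phiForm δ k₁) / h28 a k₁ := by rw [hr₁]; field_simp; ring
    have e2p : w - -r₂ = (w * h28 a k₂ + phiForm δ k₂) / h28 a k₂ := by rw [hr₂]; field_simp; ring
    have e1m : -w - -r₁ = -((w * h28 a k₁ - phiForm δ k₁) / h28 a k₁) := by rw [hr₁]; field_simp; ring
    have e2m : -w - -r₂ = -((w * h28 a k₂ - phiForm δ k₂) / h28 a k₂) := by rw [hr₂]; field_simp; ring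
    have prodP : phiForm (η • (w • sParam a + δ)) k₁ * phiForm (η • (w • sParam a + δ)) k₂ =
        (η ^ 2 * h28 a k₁ * h28 a k₂) * ((w - -r₁) * (w - -r₂)) := by
      rw [hform, hform, e1p, e2p]; field_simp
    have prodM : phiForm (η • (w • sParam a + -δ)) k₁ * phiForm (η • (w • sParam a + -δ)) k₂ =
        (η ^ 2 * h28 a k₁ * h28 a k₂) * ((-w - -r₁) * (-w - -r₂)) := by
      rw [hform, hform, e1m, e2m, phiForm_neg, phiForm_neg]; field_simp; ring
    have hc : 0 < η ^ 2 * h28 a k₁ * h28 a k₂ := mul_pos (mul_pos (pow_pos hη 2) hh1) hh2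
    have nzP : (w - -r₁) * (w - -r₂) ≠ 0 := by
      rw [e1p, e2p]; exact mul_ne_zero (div_ne_zero n1p hh1') (div_ne_zero n2p hh2')
    have nzM : (-w - -r₁) * (-w - -r₂) ≠ 0 := by
      rw [e1m, e2m]
      exact mul_ne_zero (neg_ne_zero.mpr (div_ne_zero n1m hh1')) (neg_ne_zero.mpr (div_ne_zero n2m hh2'))
    have dP := refl_two_wall_defect hpos hb hother hDp1 hDp2 hΔ₁1 hΔ₁2 hm1 hm2 ht ht1 ht2
      (Δ := η • (w • sParam a + δ))
    have dM := refl_two_wall_defect hpos hb hother hDm1 hDm2 hΔ₁1 hΔ₁2 hm1 hm2 ht ht1 ht2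
      (Δ := η • (w • sParam a + -δ))
    -- value of each defect
    have vP : (torusN (b • sParam a + η • (w • sParam a + δ)) : ℝ) +
        torusN (b • sParam a - η • (w • sParam a + δ)) -
        (torusN (b • sParam a + t • sParam a) + torusN (b • sParam a - t • sParam a)) = D * g w := by
      by_cases hw : w ∈ Ioo m M
      · rw [hg, Set.indicator_of_mem hw, mul_one]
        exact dP.1 (by rw [prodP]; exact mul_neg_of_pos_of_neg hc ((mul_sub_sub_neg_iff_mem_Ioo w _ _).mpr hw))
      · rw [hg, Set.indicator_of_notMem hw, mul_zero]
        refine dP.2 ?_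
        rw [prodP]
        refine mul_pos hc (lt_of_le_of_ne ?_ nzP.symm)
        exact not_lt.mp fun h => hw ((mul_sub_sub_neg_iff_mem_Ioo w _ _).mp h)
    have vM : (torusN (b • sParam a + η • (w • sParam a + -δ)) : ℝ) +
        torusN (b • sParam a - η • (w • sParam a + -δ)) -
        (torusN (b • sParam a + t • sParam a) + torusN (b • sParam a - t • sParam a)) = D * g (-w) := by
      by_cases hw : -w ∈ Ioo m M
      · rw [hg, Set.indicator_of_mem hw, mul_one]
        exact dM.1 (by rw [prodM]; exact mul_neg_of_pos_of_neg hc ((mul_sub_sub_neg_iff_mem_Ioo (-w) _ _).mpr hw))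
      · rw [hg, Set.indicator_of_notMem hw, mul_zero]
        refine dM.2 ?_
        rw [prodM]
        refine mul_pos hc (lt_of_le_of_ne ?_ nzM.symm)
        exact not_lt.mp fun h => hw ((mul_sub_sub_neg_iff_mem_Ioo (-w) _ _).mp h)
    rw [vP, vM]
  -- Step B: fold the mirror image and evaluate
  have hgi : ∀ α β : ℝ, IntervalIntegrable g volume α β := fun α β => by
    refine IntervalIntegrable.mono_fun' (g := fun _ => (1 : ℝ)) intervalIntegrable_const
      ((measurable_const.indicator measurableSet_Ioo).aestronglyMeasurable) ?_
    exact Filter.Eventually.of_forall fun x => by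
      rw [hg]; exact (norm_indicator_le_norm_self _ _).trans (by simp)
  have hgi' : IntervalIntegrable (fun w => g (-w)) volume 0 (clusterWidth a δ) := by
    refine IntervalIntegrable.mono_fun' (g := fun _ => (1 : ℝ)) intervalIntegrable_const
      (((measurable_const.indicator measurableSet_Ioo).comp measurable_neg).aestronglyMeasurable) ?_
    exact Filter.Eventually.of_forall fun x => by
      rw [hg]; exact (norm_indicator_le_norm_self _ _).trans (by simp)
  rw [hA, intervalIntegral.integral_add ((hgi _ _).const_mul D) (hgi'.const_mul D),
    intervalIntegral.integral_const_mul, intervalIntegral.integral_const_mul, ← mul_add]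
  have hneg : ∫ w in (0 : ℝ)..clusterWidth a δ, g (-w) = ∫ w in (-clusterWidth a δ)..0, g w := by
    have h := intervalIntegral.integral_comp_neg (a := 0) (b := clusterWidth a δ) (f := g)
    rw [neg_zero] at h
    exact h
  rw [hneg, add_comm, intervalIntegral.integral_add_adjacent_intervals (hgi _ _) (hgi _ _),
    hg, intervalIntegral_indicator_Ioo hmW hmM hMW]
  congr 1
  rw [hM, hm, max_sub_min_eq_abs, neg_sub_neg, abs_sub_comm, hr₁, hr₂]

end Summit.KontsevichZagierPeriods.Zeta5Search.Barrier.ConeGamma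

end
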